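import Summits.RiemannHypothesis.RiemannHypothesis.Theorems.WeilFormatCCinfRowMonomials
import Summits.RiemannHypothesis.RiemannHypothesis.Theorems.WeilFormatCPolyWindowEntryBox
import HarnessLib

/-!
# Format C, design C∞ (E2, data side): kernel boxes for the COLLECTED ROW COEFFICIENTS `P_row(i; t, d)`

Route context: Fourier–Galerkin / Schur-complement certificates of Weil positivity on a window ("format C", C∞ door;
cell memo `run/shared/lean/pub/rh-explicit/rh-explicit-weil-2/gen15/E2-PLAN-v2.md` §5; supporting stmt-RiemannHypothesis-0098;
seat rh-explicit-weil-2).  `abs_evenRow/oddRow_sub_collected_le` (weil-10, KERNEL-LEVER §21) write the far block rows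
`M^±(i,m)` of the sector kernels as `(−1)^m[Σ_{d≤D} P₁(i,d)/m^d + S_m·Σ_d P_S(i,d)/m^d] ± ρ·w(m)`, every `P(i,d)` an explicit
FIBER SUM of printed constants.  The rung's dominating `Uq` (`weilPositivityOn_of_cinf_poly`, hypothesis `hUqe'`) needs
kernel BOXES of these real numbers.  This file evaluates the fiber sums in fixed-point interval arithmetic from INPUT boxes
(`RowInputs`: `π`, `1/π`, `a/(2π)`, `a/π`, `a²/(4π²)`, the block constants `F_i` and `1/(1+4ω_i²)` resp. `ω_i/(1+4ω_i²)`,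
`s² = (e^{a/2} − e^{−a/2})²`, a Bernoulli list and node-moment boxes `D_s(a)` — all produced by landed box lemmas:
`MI.pi`, `WinMixed.jsBox`, light-table records, `WinPole.expHalfBoxes`, `MC.bernoulliTable42`, `CinfCoeff.nodeMomentBox`) and
proves membership for the VERBATIM fiber-sum expressions:

* `mem_evenRowPureBox` / `mem_evenRowSinBox` — tags `1` and `S_m` of the even rows (`d`-th coefficient);
* `mem_oddRowPureBox` / `mem_oddRowSinBox` — the odd rows.

Interval plumbing only; standard axioms; no RH claim.
-/

set_option autoImplicit false
-- `Summit.RiemannHypothesis.RiemannHypothesis.…` is the layout-mandated namespace (summit = problem name).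
set_option linter.dupNamespace false

open Finset Complex
open scoped Real ArithmeticFunction.vonMangoldt

namespace Summit.RiemannHypothesis.RiemannHypothesis.Theorems.WeilFormatC

open Literature.NumberTheory.LFunctions Literature.NumberTheory.LFunctions.Yoshida1992 Literature.Analysis.SpecialFunctions
open Literature.Analysis.ValidatedNumerics Literature.Analysis.ValidatedNumerics.NumericsMP

namespace CinfCoeff

open WinConst (ratBox mem_ratBox mulRatBox mem_mulRatBox)
open WinEntry (sumBox mem_sumBox)

variable {S : ℕ}

/-! ## Generic: powers, filtered sums -/

/-- `x^n` by repeated outward multiplication (local copy of the `WinPrime.powBox` recursion). -/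
def powR (S : ℕ) (X : MI) : ℕ → MI
  | 0 => MI.ofInt S 1
  | n + 1 => (powR S X n).mul S X

/-- `powR ∋ x^n`. -/
theorem mem_powR (hS : 0 < S) {x : ℝ} {X : MI} (hx : MI.mem S x X) : ∀ n : ℕ, MI.mem S (x ^ n) (powR S X n)
  | 0 => by simpa [powR] using MI.mem_ofInt S 1
  | n + 1 => by rw [pow_succ, powR]; exact MI.mem_mul hS (mem_powR hS hx n) hx

/-- A filtered range sum of boxes: `Σ_{j<J, p j} F j`. -/
def sumFilter (S : ℕ) (J : ℕ) (p : ℕ → Prop) [DecidablePred p] (F : ℕ → MI) : MI :=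
  sumBox S (fun j ↦ if p j then F j else MI.ofInt S 0) J

/-- `sumFilter ∋ Σ_{j ∈ (range J).filter p} g j`. -/
theorem mem_sumFilter {J : ℕ} {p : ℕ → Prop} [DecidablePred p] {g : ℕ → ℝ} {F : ℕ → MI}
    (h : ∀ j, j < J → p j → MI.mem S (g j) (F j)) :
    MI.mem S (∑ j ∈ (Finset.range J).filter p, g j) (sumFilter S J p F) := by
  rw [Finset.sum_filter, sumFilter]
  refine mem_sumBox J fun j hj ↦ ?_
  by_cases hp : p j
  · rw [if_pos hp, if_pos hp]; exact h j hj hp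
  · rw [if_neg hp, if_neg hp]; simpa using MI.mem_ofInt S 0

/-- A filtered double sum of boxes over `[1,K] × [0,J)`: `Σ_{N,j: p(N,j)} F N j`. -/
def sumFilter2 (S : ℕ) (K J : ℕ) (p : ℕ × ℕ → Prop) [DecidablePred p] (F : ℕ → ℕ → MI) : MI :=
  sumBox S (fun n ↦ sumFilter S J (fun j ↦ p (n + 1, j)) (F (n + 1))) K

/-- `sumFilter2 ∋ Σ_{q ∈ (Icc 1 K ×ˢ range J).filter p} g q`. -/
theorem mem_sumFilter2 {K J : ℕ} {p : ℕ × ℕ → Prop} [DecidablePred p] {g : ℕ × ℕ → ℝ} {F : ℕ → ℕ → MI}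
    (h : ∀ N j, 1 ≤ N → N ≤ K → j < J → p (N, j) → MI.mem S (g (N, j)) (F N j)) :
    MI.mem S (∑ q ∈ (Finset.Icc 1 K ×ˢ Finset.range J).filter p, g q)
      (sumFilter2 S K J p F) := by
  rw [Finset.sum_filter, Finset.sum_product, sumFilter2]
  have hIcc : ∑ N ∈ Finset.Icc 1 K, ∑ j ∈ Finset.range J, (if p (N, j) then g (N, j) else 0)
      = ∑ n ∈ Finset.range K, ∑ j ∈ Finset.range J, (if p (n + 1, j) then g (n + 1, j) else 0) := by
    rw [← Finset.Ico_succ_right_eq_Icc, Order.succ_eq_add_one, Finset.sum_Ico_eq_sum_range,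
      show K + 1 - 1 = K by omega]
    simp only [add_comm 1]
  rw [hIcc]
  refine mem_sumBox K fun n hn ↦ ?_
  rw [← Finset.sum_filter]
  exact mem_sumFilter (p := fun j ↦ p (n + 1, j)) fun j hj hp ↦ h (n + 1) j (by omega) (by omega) hj hp

/-- A filtered double sum over `[0,R) × [0,J)`. -/
def sumFilter2' (S : ℕ) (R J : ℕ) (p : ℕ × ℕ → Prop) [DecidablePred p] (F : ℕ → ℕ → MI) : MI :=
  sumBox S (fun r ↦ sumFilter S J (fun j ↦ p (r, j)) (F r)) R

/-- `sumFilter2' ∋ Σ_{q ∈ (range R ×ˢ range J).filter p} g q`. -/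
theorem mem_sumFilter2' {R J : ℕ} {p : ℕ × ℕ → Prop} [DecidablePred p] {g : ℕ × ℕ → ℝ} {F : ℕ → ℕ → MI}
    (h : ∀ r j, r < R → j < J → p (r, j) → MI.mem S (g (r, j)) (F r j)) :
    MI.mem S (∑ q ∈ (Finset.range R ×ˢ Finset.range J).filter p, g q)
      (sumFilter2' S R J p F) := by
  rw [Finset.sum_filter, Finset.sum_product, sumFilter2']
  refine mem_sumBox R fun r hr ↦ ?_
  rw [← Finset.sum_filter]
  exact mem_sumFilter (p := fun j ↦ p (r, j)) fun j hj hp ↦ h r j hr hj hp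

/-! ## The Stirling coefficient `σ_N b_N` / `c_N b_N` as exact rationals -/

/-- `b_N = 1 − 1/(2N) − ½Σ_{l∈[1,ν]} (B_{2l}/(2l)) 16^l C(N−1,2l−1)` from a Bernoulli list `bt` (`bt[l−1] = B_{2l}`). -/
def bNQ (bt : List ℚ) (ν N : ℕ) : ℚ :=
  1 - 1 / (2 * (N : ℚ)) - (∑ l ∈ Finset.Icc 1 ν, bt.getD (l - 1) 0 / (2 * l) * 16 ^ l * (((N - 1).choose (2 * l - 1) : ℕ) : ℚ)) / 2

/-- With a correct Bernoulli list `bNQ` IS the real `b_N`. -/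
theorem bNQ_cast (bt : List ℚ) {ν : ℕ} (hbt : ∀ k, k < ν → bt.getD k 0 = bernoulli (2 * (k + 1))) (N : ℕ) :
    ((bNQ bt ν N : ℚ) : ℝ) = 1 - 1 / (2 * (N : ℝ))
      - (∑ l ∈ Finset.Icc 1 ν, (bernoulli (2 * l) : ℝ) / (2 * l) * 16 ^ l * (((N - 1).choose (2 * l - 1) : ℕ) : ℝ)) / 2 := by
  rw [bNQ]; push_cast
  congr 2
  refine Finset.sum_congr rfl fun l hl ↦ ?_
  rw [Finset.mem_Icc] at hl
  have h := hbt (l - 1) (by omega)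
  rw [show l - 1 + 1 = l by omega] at h
  rw [h]

/-- `σ_N = (0, 1, 0, −1)` by `N mod 4`. -/
def sigQ (N : ℕ) : ℚ := if N % 4 = 1 then 1 else if N % 4 = 3 then -1 else 0

/-- Cast of `σ_N`. -/
theorem sigQ_cast (N : ℕ) : ((sigQ N : ℚ) : ℝ) = (if N % 4 = 1 then (1 : ℝ) else if N % 4 = 3 then -1 else 0) := by
  unfold sigQ; split_ifs <;> simp

/-! ## Inputs -/

/-- Input boxes of one block row `i` (all obtainable from landed box lemmas; see the module docstring). -/
structure RowInputs where
  /-- `∋ π` -/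
  P : MI
  /-- `∋ 1/π` -/
  Pinv : MI
  /-- `∋ a/(2π)` -/
  A2P : MI
  /-- `∋ a/π` -/
  AP : MI
  /-- `∋ a²/(4π²)` -/
  QQ : MI
  /-- `∋ F_i = ½Im ψ(¼+iω_i/2) + S(ω_i) − T(ω_i)` -/
  Fi : MI
  /-- even: `∋ 1/(1+4ω_i²)`; odd: `∋ ω_i/(1+4ω_i²)` -/
  Ci : MI
  /-- `∋ (e^{a/2} − e^{−a/2})²` -/
  S2 : MI
  /-- Bernoulli list, `bt[l−1] = B_{2l}` -/
  bt : List ℚ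
  /-- node-moment boxes, `Dl[s] ∋ D_s(a)` -/
  Dl : List MI

/-- Validity of the inputs for the window `a`, block row `i`, Stirling order `ν`, polar order `R`; `c` is the block
weight (`1/(1+4ω_i²)` even, `ω_i/(1+4ω_i²)` odd). -/
structure RowInputsValid (S : ℕ) (a : ℚ) (i ν R : ℕ) (c : ℝ) (X : RowInputs) : Prop where
  hP : MI.mem S Real.pi X.P
  hPinv : MI.mem S (1 / Real.pi) X.Pinv
  hA2P : MI.mem S ((a : ℝ) / (2 * Real.pi)) X.A2P
  hAP : MI.mem S ((a : ℝ) / Real.pi) X.AP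
  hQQ : MI.mem S ((a : ℝ) ^ 2 / (4 * Real.pi ^ 2)) X.QQ
  hFi : MI.mem S ((Complex.digamma (1 / 4 + ((freq (a : ℝ) i : ℝ) : ℂ) / 2 * I)).im / 2
          + (∑ k ∈ weilPrimeIndex (a : ℝ), (Λ k : ℝ) / Real.sqrt k * Real.sin (freq (a : ℝ) i * Real.log k))
          - archExpSumSin (a : ℝ) i) X.Fi
  hCi : MI.mem S c X.Ci
  hS2 : MI.mem S ((Real.exp ((a : ℝ) / 2) - Real.exp (-((a : ℝ) / 2))) ^ 2) X.S2
  hbt : ∀ k, k < ν → X.bt.getD k 0 = bernoulli (2 * (k + 1))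
  hD : ∀ s, s ≤ 2 * R + 1 →
    MI.mem S (∑' k : ℕ, Real.exp (-(2 * (a : ℝ) * digammaNode k)) * digammaNode k ^ s) (X.Dl.getD s default)

/-! ## Even rows -/

section Even

variable {a : ℚ} {i ν R : ℕ} {X : RowInputs}

/-- The even weight `(−1)^i i^{2j}` as an integer. -/
def wE (i j : ℕ) : ℤ := (-1) ^ i * (i : ℤ) ^ (2 * j)

/-- Cast of `wE`. -/
theorem wE_cast (i j : ℕ) : ((wE i j : ℤ) : ℝ) = (-1 : ℝ) ^ i * (i : ℝ) ^ (2 * j) := by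
  unfold wE; push_cast; ring

/-- Box of the `d`-th PURE-tag coefficient of the even row `i`:
`Σ_{2j+1=d} (π/4)w_j/π + Σ_{N+2j+1=d} σ_N b_N (a/2π)^N w_j/π − Σ_{2r+1+2j+1=d} (−1)^r D_{2r}(a/π)^{2r+1} w_j/π`
`+ Σ_{2r+2=d} (−1)^i(−i^{2r+1}F_i/π + (4/a)s²(−1)^r qq^{r+1} c_i)`. -/
def evenRowPureBox (S : ℕ) (X : RowInputs) (a : ℚ) (i ν K R J d : ℕ) : MI :=
  (((sumFilter S J (fun j ↦ 2 * j + 1 = d) (fun j ↦ ratBox S ((wE i j : ℚ) / 4))).add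
    (sumFilter2 S K J (fun q ↦ q.1 + (2 * q.2 + 1) = d)
      (fun N j ↦ (mulRatBox (powR S X.A2P N) (sigQ N * bNQ X.bt ν N * wE i j)).mul S X.Pinv))).sub
    (sumFilter2' S R J (fun q ↦ (2 * q.1 + 1) + (2 * q.2 + 1) = d)
      (fun r j ↦ ((mulRatBox ((X.Dl.getD (2 * r) default).mul S (powR S X.AP (2 * r + 1)))
        ((-1 : ℚ) ^ r * wE i j)).mul S X.Pinv)))).add
    (sumFilter S J (fun r ↦ 2 * r + 2 = d)
      (fun r ↦ (mulRatBox (X.Fi.mul S X.Pinv) (-((-1 : ℚ) ^ i * (i : ℚ) ^ (2 * r + 1)))).add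
        (mulRatBox ((X.S2.mul S (powR S X.QQ (r + 1))).mul S X.Ci) (4 / a * (-1 : ℚ) ^ r * (-1) ^ i))))

/-- **`evenRowPureBox ∋ P₁(i,d)`**, the `d`-th pure-tag fiber sum of `abs_evenRow_sub_collected_le` (verbatim). -/
theorem mem_evenRowPureBox (hS : 0 < S) (ha : 0 < a) (hX : RowInputsValid S a i ν R (1 / (1 + 4 * freq (a : ℝ) i ^ 2)) X)
    (K J d : ℕ) :
    MI.mem S
      ((∑ j ∈ (Finset.range J).filter (fun j ↦ (2 * j + 1) = d),
          π / 4 * ((-1 : ℝ) ^ i * (i : ℝ) ^ (2 * j)) / Real.pi)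
        + (∑ p ∈ (Finset.Icc 1 K ×ˢ Finset.range J).filter (fun p ↦ p.1 + (2 * p.2 + 1) = d),
            (fun N : ℕ ↦ (if N % 4 = 1 then (1 : ℝ) else if N % 4 = 3 then -1 else 0)
              * (1 - 1 / (2 * (N : ℝ))
                  - (∑ l ∈ Finset.Icc 1 ν, (bernoulli (2 * l) : ℝ) / (2 * l) * 16 ^ l
                      * (((N - 1).choose (2 * l - 1) : ℕ) : ℝ)) / 2)
              * ((a : ℝ) / (2 * π)) ^ N) p.1
              * ((-1 : ℝ) ^ i * (i : ℝ) ^ (2 * p.2)) / Real.pi)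
        - (∑ p ∈ (Finset.range R ×ˢ Finset.range J).filter (fun p ↦ (2 * p.1 + 1) + (2 * p.2 + 1) = d),
            (fun r : ℕ ↦ (-1 : ℝ) ^ r *
              (∑' l : ℕ, Real.exp (-(2 * (a : ℝ) * digammaNode l)) * digammaNode l ^ (2 * r)) * ((a : ℝ) / π) ^ (2 * r + 1)) p.1
              * ((-1 : ℝ) ^ i * (i : ℝ) ^ (2 * p.2)) / Real.pi)
        + (∑ r ∈ (Finset.range J).filter (fun r ↦ (2 * r + 2) = d),
            (fun r : ℕ ↦ (-1 : ℝ) ^ i *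
              (-((i : ℝ) ^ (2 * r + 1)) * ((Complex.digamma (1 / 4 + ((freq (a : ℝ) i : ℝ) : ℂ) / 2 * I)).im / 2
                  + (∑ k ∈ weilPrimeIndex (a : ℝ), (Λ k : ℝ) / Real.sqrt k * Real.sin (freq (a : ℝ) i * Real.log k))
                  - archExpSumSin (a : ℝ) i) / π
                + 4 / (a : ℝ) * (Real.exp ((a : ℝ) / 2) - Real.exp (-((a : ℝ) / 2))) ^ 2 * (-1 : ℝ) ^ r
                  * ((a : ℝ) ^ 2 / (4 * π ^ 2)) ^ (r + 1) * (1 / (1 + 4 * freq (a : ℝ) i ^ 2)))) r))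
      (evenRowPureBox S X a i ν K R J d) := by
  have hπ : Real.pi ≠ 0 := Real.pi_ne_zero
  have ha' : (a : ℝ) ≠ 0 := by exact_mod_cast ha.ne'
  set F : ℝ := (Complex.digamma (1 / 4 + ((freq (a : ℝ) i : ℝ) : ℂ) / 2 * I)).im / 2
          + (∑ k ∈ weilPrimeIndex (a : ℝ), (Λ k : ℝ) / Real.sqrt k * Real.sin (freq (a : ℝ) i * Real.log k))
          - archExpSumSin (a : ℝ) i with hFdef
  unfold evenRowPureBox
  refine MI.mem_add (MI.mem_sub (MI.mem_add ?_ ?_) ?_) ?_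
  · -- Σ_{2j+1=d} (π/4) w_j / π = w_j/4
    refine mem_sumFilter fun j _ _ ↦ ?_
    have e : π / 4 * ((-1 : ℝ) ^ i * (i : ℝ) ^ (2 * j)) / Real.pi = (((wE i j : ℚ) / 4 : ℚ) : ℝ) := by
      push_cast; rw [wE_cast]; field_simp
    rw [e]; exact mem_ratBox S _
  · -- Σ_{N+2j+1=d} σ_N b_N (a/2π)^N w_j / π
    refine mem_sumFilter2 fun N j _ _ _ _ ↦ ?_
    have hpow := mem_powR hS hX.hA2P N
    have hm := MI.mem_mul hS (mem_mulRatBox hpow (sigQ N * bNQ X.bt ν N * wE i j)) hX.hPinv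
    convert hm using 1
    push_cast
    rw [sigQ_cast, bNQ_cast X.bt hX.hbt, wE_cast]
    field_simp
  · -- Σ (−1)^r D_{2r} (a/π)^{2r+1} w_j / π
    refine mem_sumFilter2' fun r j hr _ _ ↦ ?_
    have hDm := hX.hD (2 * r) (by omega)
    have hm := MI.mem_mul hS (mem_mulRatBox (MI.mem_mul hS hDm (mem_powR hS hX.hAP (2 * r + 1))) ((-1 : ℚ) ^ r * wE i j)) hX.hPinv
    convert hm using 1
    push_cast; rw [wE_cast]; field_simp
  · -- Σ_{2r+2=d} (−1)^i(−i^{2r+1} F_i/π + (4/a) s² (−1)^r qq^{r+1} c_i)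
    refine mem_sumFilter fun r _ _ ↦ ?_
    have h1 := mem_mulRatBox (MI.mem_mul hS hX.hFi hX.hPinv) (-((-1 : ℚ) ^ i * (i : ℚ) ^ (2 * r + 1)))
    have h2 := mem_mulRatBox (MI.mem_mul hS (MI.mem_mul hS hX.hS2 (mem_powR hS hX.hQQ (r + 1))) hX.hCi)
      (4 / a * (-1 : ℚ) ^ r * (-1) ^ i)
    convert MI.mem_add h1 h2 using 1
    rw [← hFdef]
    push_cast
    field_simp

/-- Box of the `d`-th `S_m`-tag coefficient of the even row `i`: `Σ_{2j+1=d} (−1)^i i^{2j}/π`. -/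
def evenRowSinBox (S : ℕ) (X : RowInputs) (i J d : ℕ) : MI :=
  sumFilter S J (fun j ↦ 2 * j + 1 = d) (fun j ↦ X.Pinv.mulInt (wE i j))

/-- **`evenRowSinBox ∋ P_S(i,d)`** (verbatim). -/
theorem mem_evenRowSinBox {c : ℝ} (hX : RowInputsValid S a i ν R c X) (J d : ℕ) :
    MI.mem S (∑ j ∈ (Finset.range J).filter (fun j ↦ (2 * j + 1) = d), ((-1 : ℝ) ^ i * (i : ℝ) ^ (2 * j)) / Real.pi)
      (evenRowSinBox S X i J d) := by
  unfold evenRowSinBox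
  refine mem_sumFilter fun j _ _ ↦ ?_
  have hm := MI.mem_mulInt hX.hPinv (wE i j)
  convert hm using 1
  rw [wE_cast]; field_simp

end Even

/-! ## Odd rows -/

section Odd

variable {a : ℚ} {i ν R : ℕ} {X : RowInputs}

/-- The odd weight `(−1)^i i^{2j+1}` as an integer. -/
def wO (i j : ℕ) : ℤ := (-1) ^ i * (i : ℤ) ^ (2 * j + 1)

/-- Cast of `wO`. -/
theorem wO_cast (i j : ℕ) : ((wO i j : ℤ) : ℝ) = (-1 : ℝ) ^ i * (i : ℝ) ^ (2 * j + 1) := by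
  unfold wO; push_cast; ring

/-- Box of the `d`-th PURE-tag coefficient of the odd row `i` (the `Ci` input is `ω_i/(1+4ω_i²)` here):
`Σ_{2j+2=d} (π/4)w_j/π + Σ_{N+2j+2=d} σ_N b_N (a/2π)^N w_j/π − Σ_{2r+1+2j+2=d} (−1)^r D_{2r}(a/π)^{2r+1} w_j/π`
`+ Σ_{2r+1=d} (−1)^i(−i^{2r}F_i/π − (4/π)s²(−1)^r qq^r d_i)`. -/
def oddRowPureBox (S : ℕ) (X : RowInputs) (i ν K R J d : ℕ) : MI :=
  (((sumFilter S J (fun j ↦ 2 * j + 2 = d) (fun j ↦ ratBox S ((wO i j : ℚ) / 4))).add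
    (sumFilter2 S K J (fun q ↦ q.1 + (2 * q.2 + 2) = d)
      (fun N j ↦ (mulRatBox (powR S X.A2P N) (sigQ N * bNQ X.bt ν N * wO i j)).mul S X.Pinv))).sub
    (sumFilter2' S R J (fun q ↦ (2 * q.1 + 1) + (2 * q.2 + 2) = d)
      (fun r j ↦ ((mulRatBox ((X.Dl.getD (2 * r) default).mul S (powR S X.AP (2 * r + 1)))
        ((-1 : ℚ) ^ r * wO i j)).mul S X.Pinv)))).add
    (sumFilter S J (fun r ↦ 2 * r + 1 = d)
      (fun r ↦ (mulRatBox (X.Fi.mul S X.Pinv) (-((-1 : ℚ) ^ i * (i : ℚ) ^ (2 * r)))).add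
        (mulRatBox (((X.S2.mul S X.Pinv).mul S (powR S X.QQ r)).mul S X.Ci) (-(4 * (-1 : ℚ) ^ r * (-1) ^ i)))))

/-- **`oddRowPureBox ∋ P₁(i,d)`**, the `d`-th pure-tag fiber sum of `abs_oddRow_sub_collected_le` (verbatim). -/
theorem mem_oddRowPureBox (hS : 0 < S) (ha : 0 < a)
    (hX : RowInputsValid S a i ν R (freq (a : ℝ) i / (1 + 4 * freq (a : ℝ) i ^ 2)) X) (K J d : ℕ) :
    MI.mem S
      ((∑ j ∈ (Finset.range J).filter (fun j ↦ (2 * j + 2) = d),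
          π / 4 * ((-1 : ℝ) ^ i * (i : ℝ) ^ (2 * j + 1)) / Real.pi)
        + (∑ p ∈ (Finset.Icc 1 K ×ˢ Finset.range J).filter (fun p ↦ p.1 + (2 * p.2 + 2) = d),
            (fun N : ℕ ↦ (if N % 4 = 1 then (1 : ℝ) else if N % 4 = 3 then -1 else 0)
              * (1 - 1 / (2 * (N : ℝ))
                  - (∑ l ∈ Finset.Icc 1 ν, (bernoulli (2 * l) : ℝ) / (2 * l) * 16 ^ l
                      * (((N - 1).choose (2 * l - 1) : ℕ) : ℝ)) / 2)
              * ((a : ℝ) / (2 * π)) ^ N) p.1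
              * ((-1 : ℝ) ^ i * (i : ℝ) ^ (2 * p.2 + 1)) / Real.pi)
        - (∑ p ∈ (Finset.range R ×ˢ Finset.range J).filter (fun p ↦ (2 * p.1 + 1) + (2 * p.2 + 2) = d),
            (fun r : ℕ ↦ (-1 : ℝ) ^ r *
              (∑' l : ℕ, Real.exp (-(2 * (a : ℝ) * digammaNode l)) * digammaNode l ^ (2 * r)) * ((a : ℝ) / π) ^ (2 * r + 1)) p.1
              * ((-1 : ℝ) ^ i * (i : ℝ) ^ (2 * p.2 + 1)) / Real.pi)
        + (∑ r ∈ (Finset.range J).filter (fun r ↦ (2 * r + 1) = d),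
            (fun r : ℕ ↦ (-1 : ℝ) ^ i *
              (-((i : ℝ) ^ (2 * r)) * ((Complex.digamma (1 / 4 + ((freq (a : ℝ) i : ℝ) : ℂ) / 2 * I)).im / 2
                  + (∑ k ∈ weilPrimeIndex (a : ℝ), (Λ k : ℝ) / Real.sqrt k * Real.sin (freq (a : ℝ) i * Real.log k))
                  - archExpSumSin (a : ℝ) i) / π
                - 4 * (Real.exp ((a : ℝ) / 2) - Real.exp (-((a : ℝ) / 2))) ^ 2 / π * (-1 : ℝ) ^ r
                  * ((a : ℝ) ^ 2 / (4 * π ^ 2)) ^ r * (freq (a : ℝ) i / (1 + 4 * freq (a : ℝ) i ^ 2)))) r))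
      (oddRowPureBox S X i ν K R J d) := by
  have hπ : Real.pi ≠ 0 := Real.pi_ne_zero
  have ha' : (a : ℝ) ≠ 0 := by exact_mod_cast ha.ne'
  set F : ℝ := (Complex.digamma (1 / 4 + ((freq (a : ℝ) i : ℝ) : ℂ) / 2 * I)).im / 2
          + (∑ k ∈ weilPrimeIndex (a : ℝ), (Λ k : ℝ) / Real.sqrt k * Real.sin (freq (a : ℝ) i * Real.log k))
          - archExpSumSin (a : ℝ) i with hFdef
  set c : ℝ := freq (a : ℝ) i / (1 + 4 * freq (a : ℝ) i ^ 2) with hcdef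
  unfold oddRowPureBox
  refine MI.mem_add (MI.mem_sub (MI.mem_add ?_ ?_) ?_) ?_
  · refine mem_sumFilter fun j _ _ ↦ ?_
    have e : π / 4 * ((-1 : ℝ) ^ i * (i : ℝ) ^ (2 * j + 1)) / Real.pi = (((wO i j : ℚ) / 4 : ℚ) : ℝ) := by
      push_cast; rw [wO_cast]; field_simp
    rw [e]; exact mem_ratBox S _
  · refine mem_sumFilter2 fun N j _ _ _ _ ↦ ?_
    have hpow := mem_powR hS hX.hA2P N
    have hm := MI.mem_mul hS (mem_mulRatBox hpow (sigQ N * bNQ X.bt ν N * wO i j)) hX.hPinv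
    convert hm using 1
    push_cast
    rw [sigQ_cast, bNQ_cast X.bt hX.hbt, wO_cast]
    field_simp
  · refine mem_sumFilter2' fun r j hr _ _ ↦ ?_
    have hDm := hX.hD (2 * r) (by omega)
    have hm := MI.mem_mul hS (mem_mulRatBox (MI.mem_mul hS hDm (mem_powR hS hX.hAP (2 * r + 1))) ((-1 : ℚ) ^ r * wO i j)) hX.hPinv
    convert hm using 1
    push_cast; rw [wO_cast]; field_simp
  · refine mem_sumFilter fun r _ _ ↦ ?_
    have h1 := mem_mulRatBox (MI.mem_mul hS hX.hFi hX.hPinv) (-((-1 : ℚ) ^ i * (i : ℚ) ^ (2 * r)))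
    have h2 := mem_mulRatBox (MI.mem_mul hS (MI.mem_mul hS (MI.mem_mul hS hX.hS2 hX.hPinv) (mem_powR hS hX.hQQ r)) hX.hCi)
      (-(4 * (-1 : ℚ) ^ r * (-1) ^ i))
    convert MI.mem_add h1 h2 using 1
    rw [← hFdef]
    push_cast
    field_simp
    ring

/-- Box of the `d`-th `S_m`-tag coefficient of the odd row `i`: `Σ_{2j+2=d} (−1)^i i^{2j+1}/π`. -/
def oddRowSinBox (S : ℕ) (X : RowInputs) (i J d : ℕ) : MI :=
  sumFilter S J (fun j ↦ 2 * j + 2 = d) (fun j ↦ X.Pinv.mulInt (wO i j))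

/-- **`oddRowSinBox ∋ P_S(i,d)`** (verbatim). -/
theorem mem_oddRowSinBox {c : ℝ} (hX : RowInputsValid S a i ν R c X) (J d : ℕ) :
    MI.mem S (∑ j ∈ (Finset.range J).filter (fun j ↦ (2 * j + 2) = d), ((-1 : ℝ) ^ i * (i : ℝ) ^ (2 * j + 1)) / Real.pi)
      (oddRowSinBox S X i J d) := by
  unfold oddRowSinBox
  refine mem_sumFilter fun j _ _ ↦ ?_
  have hm := MI.mem_mulInt hX.hPinv (wO i j)
  convert hm using 1
  rw [wO_cast]; field_simp

end Odd

end CinfCoeff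

end Summit.RiemannHypothesis.RiemannHypothesis.Theorems.WeilFormatC
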